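import Literature.GroupTheory.SpecificGroups.PadicQuadraticAffineSlim
import Literature.AnabelianGeometry.SemiGraphs.ArithTotalEstrangementTransportWitness
import Literature.AnabelianGeometry.SemiGraphs.WitnessIwahoriLoop
import HarnessLib

/-!
# The quadratic loop graph of anabelioids `𝓛′(p)`: one vertex `B(πR ⋊ U_ℝ)`, one estranged loop `B(U_ℝ)`
# over the quadratic order `R = ℤ_p[√p]` (NV-T54 stage 2a, part 1: the object and its non-approximator clauses)

S. Mochizuki, *Semi-graphs of anabelioids*, Publ. RIMS **42** (2006) 221–322: Def. 2.1 p. 22 (semi-graph of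
anabelioids, of injective type), Def. 2.4 (ii) p. 25 (verticially slim), Def. 2.4 (iv) p. 26 (aloof /
estranged edges), §1 p. 11 and p. 16 (the graph `H_1`), Thm. 3.7 p. 40 (standing hypotheses, the tree's
`ProfiniteSemiGraph.Thm37Hypotheses`), §5 Def. 5.3 p. 65 / Thm. 5.4 p. 66 (the arithmetic setting this
carrier is built for). [cite: MochizukiSemiAnbd2006, Thm 3.7 p.40]

DEFS file of the abc-iut cell (layer L3 [SemiAnbd]; row «NV-T54-RESIDUAL stage 2a», abc-iut-L3-lead gen 8
δ40 (1) GO 2026-08-27; seat abc-iut-w6-d099 gen 8; design credit abc-iut-w4-d029 gen 6 HANDOFF #2; stage 1 =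
the abstract joint witness `ArithTotalEstrangementTransportWitness.lean`, p494027).  TARGET of the stage: the
typed hypothesis bundle `Thm37Hypotheses` of [SemiAnbd] Thm. 3.7 at a semi-graph of anabelioids WITH AN EDGE
whose vertex group is the GEOMETRIC vertex group `πR ⋊ U_ℝ` of the quadratic affine carrier
`G = R ⋊ (U_ℝ × U)` (`Literature/GroupTheory/SpecificGroups/PadicQuadratic{OneUnits,AffineGroup,AffineLevel,
AffineSlim}.lean`), so that the later stages (2b tempered chart, 3 outer `U`-action with kernel `U_ℝ`,
4 `hCCt`, 5 transfer of `hest` along `IsTotallyArithEstranged.of_map` and CAPSTONE v9 instantiation) have a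
genuine Thm-3.7 carrier at which the Thm 5.4 binder list refuted at the Iwahori charts `loopGraph p` /
`doubleLoop p` (abc-iut-f-177, p470380 / p492697) can be inhabited.

THE OBJECT `quadLoopGraph p` (local presentation `ProfiniteSemiGraph`, universe `0`), in the format of
abc-iut-w5-d236's `IwahoriWitness.loopGraph`: underlying semi-graph the bouquet `H_1` (one vertex, one edge
`e`, branches `(0,false)`, `(0,true)` both abutting to the vertex); vertex group
`Π_v := πR ⋊ U_ℝ = PadicQuadAffine.geomVertexGp p` (triples `(a, w, 1)`, `re a ∈ pℤ_p`, `w ∈ U` real);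
edge group `Π_e := U_ℝ = PadicQuadOneUnits.real p` (`≅ 1 + pℤ_p`); branch maps the geometric branch
homomorphisms of `PadicQuadraticAffineSlim.lean` BY NAME: `(0,false) ↦ geomBrHom 0`, `w ↦ (0, w, 1)` (real
scalings centred at `0`) and `(0,true) ↦ geomBrHom 1`, `w ↦ (1 − w, w, 1)` (real scalings centred at `1`).

KERNEL-CHECKED CLAUSES (this file): `isGraph`, `hasVertex`, `isCountable`, `isConnected` (the bouquet lemmas
of `WitnessIwahoriLoop` BY NAME), `isOfInjectiveType` (`geomBrHom_injective`), `isVerticiallySlim`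
(`PadicQuadAffine.centralizer_eq_bot_of_isOpen`, p494624), `isTotallyAloof`, `isTotallyEstranged`: for branch
points `y, y′ ∈ {0,1}` and `g ∈ Π_v`, `B_y ∩ g B_{y′} g⁻¹ = 1` as soon as `y′ ≠ y` or `g ∉ B_y` — pushed into
`G` this is `QuadAffineWitness.stab_inf_ker_inf_eq_bot` (two fixed points force a trivial linear part in the
DOMAIN `ℤ_p[√p]`) at the points `y ≠ g · y′` (`PadicQuadAffine.act_one_ne_zero` / `act_zero_ne_one`, resp.
`g · y = y ⇒ g ∈ B_y`); infinite index because `U_ℝ` is infinite.  Deliberately NOT here (part 2, PROOF-ONLY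
companion `QuadraticLoopGraphThm37.lean`): the approximator clauses (quasi-coherent, totally elevated),
Galois-countability and the assembled bundle.

HONEST SCOPE: a consistency carrier for the typed hypothesis bundles; it is not the semi-graph of
anabelioids of any curve and nothing here is a statement about [SemiAnbd] Ex. 5.6 in print; no side is taken
on [IUTchIII] Cor. 3.12; typed ≠ proved. [cite: MochizukiSemiAnbd2006, Def 2.4 p.25-26]
-/

noncomputable section

namespace Literature.AnabelianGeometry.SemiGraphs

open Literature.AlgebraicGeometry.Frobenioids (IsSlimGroup)
open Literature.GroupTheory.SpecificGroups
open scoped QuadraticAlgebra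

namespace QuadAffineWitness

open PadicQuadAffine PadicQuadOneUnits

variable (p : ℕ) [Fact p.Prime]

/-! ## 1. The object -/

/-- The branch point of a branch of `H_1`: `false ↦ 0`, `true ↦ 1` (the two «cusps» `0, 1 ∈ R` at which the
real scalings of the two branches are centred). [cite: MochizukiSemiAnbd2006, Def 2.1 p.22] -/
def brPoint (b : (SemiGraph.bouquet.{0} 1).Branch) : PadicQuad p := if b.down.2 then 1 else 0

/-- **The quadratic loop graph of anabelioids `𝓛′(p)`**: the bouquet `H_1` with vertex group
`πR ⋊ U_ℝ = geomVertexGp p`, edge group `U_ℝ = real p`, and branch maps the geometric branch homomorphisms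
`geomBrHom 0` (real scalings centred at `0`) and `geomBrHom 1` (real scalings centred at `1`).
[cite: MochizukiSemiAnbd2006, Def 2.1 p.22] -/
def quadLoopGraph : ProfiniteSemiGraph.{0} where
  graph := SemiGraph.bouquet.{0} 1
  Gv _ := geomVertexGp p
  Ge _ := real p
  brHom b _ _ := geomBrHom (brPoint p b)

/-- The branch maps of `𝓛′(p)` are the geometric branch homomorphisms centred at the branch points.
[cite: MochizukiSemiAnbd2006, Def 2.1 p.22] -/
@[simp] theorem quadLoopGraph_brHom (b : (SemiGraph.bouquet.{0} 1).Branch)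
    (v : (SemiGraph.bouquet.{0} 1).Vertex) (h : (SemiGraph.bouquet.{0} 1).abuts b = some v) :
    (quadLoopGraph p).brHom b v h = geomBrHom (brPoint p b) := rfl

/-- The branch subgroups `B_y ⊆ πR ⋊ U_ℝ` of `𝓛′(p)` are the ranges of the `geomBrHom y`.
[cite: MochizukiSemiAnbd2006, §2 p.23] -/
theorem quadLoopGraph_branchSubgroup (b : (SemiGraph.bouquet.{0} 1).Branch)
    (v : (SemiGraph.bouquet.{0} 1).Vertex) (h : (SemiGraph.bouquet.{0} 1).abuts b = some v) :
    (quadLoopGraph p).branchSubgroup b v h = (geomBrHom (p := p) (brPoint p b)).toMonoidHom.range := rfl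

/-- In `G`, the value of a branch map at `w` is the element `((1 − w) y, w, 1) = brElt y w`.
[cite: MochizukiSemiAnbd2006, Def 2.1 p.22] -/
theorem subtype_quadLoopGraph_brHom_apply (b : (SemiGraph.bouquet.{0} 1).Branch)
    (v : (SemiGraph.bouquet.{0} 1).Vertex) (h : (SemiGraph.bouquet.{0} 1).abuts b = some v) (w : real p) :
    (geomVertexGp p).subtype ((quadLoopGraph p).brHom b v h w) = brElt (brPoint p b) w := rfl

/-- The branch points are REAL (`im = 0`). [cite: MochizukiSemiAnbd2006, Def 2.1 p.22] -/
@[simp] theorem brPoint_im (b : (SemiGraph.bouquet.{0} 1).Branch) : (brPoint p b).im = 0 := by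
  unfold brPoint; split_ifs <;> simp [QuadraticAlgebra.im_one]

/-- Distinct branches of `𝓛′(p)` carry the branch-point pair `{0, 1}`. [cite: MochizukiSemiAnbd2006, §1 p.16] -/
theorem brPoint_pair_of_ne {b b' : (SemiGraph.bouquet.{0} 1).Branch} (h : b' ≠ b) :
    (brPoint p b = 0 ∧ brPoint p b' = 1) ∨ (brPoint p b = 1 ∧ brPoint p b' = 0) := by
  have hne := IwahoriWitness.bouquet_one_branch_ne h
  unfold brPoint
  rcases hb : b.down.2 with _ | _ <;> rcases hb' : b'.down.2 with _ | _ <;> simp_all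

/-! ## 2. The combinatorial clauses -/

/-- `𝓛′(p)` is a graph (every branch abuts). [cite: MochizukiSemiAnbd2006, §1 p.11] -/
theorem quadLoopGraph_isGraph : (quadLoopGraph p).IsGraph := SemiGraph.bouquet_isGraph 1

/-- `𝓛′(p)` has a vertex. [cite: MochizukiSemiAnbd2006, Thm 3.7 p.40] -/
theorem quadLoopGraph_hasVertex : (quadLoopGraph p).HasVertex := ⟨PUnit.unit⟩

/-- `𝓛′(p)` is countable (indeed finite). [cite: MochizukiSemiAnbd2006, §1 p.11] -/
theorem quadLoopGraph_isCountable : (quadLoopGraph p).IsCountable :=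
  ⟨inferInstanceAs (Countable PUnit), inferInstanceAs (Countable (ULift (Fin 1)))⟩

/-- `𝓛′(p)` is connected (the bouquet `H_1` is). [cite: MochizukiSemiAnbd2006, §1 p.11] -/
theorem quadLoopGraph_isConnected : (quadLoopGraph p).IsConnected := IwahoriWitness.bouquet_one_isConnected

/-- The vertex, edge and branch sets of `𝓛′(p)` are finite. [cite: MochizukiSemiAnbd2006, §1 p.11] -/
theorem quadLoopGraph_isFinite : (quadLoopGraph p).graph.IsFinite :=
  ⟨inferInstanceAs (Finite PUnit), inferInstanceAs (Finite (ULift (Fin 1)))⟩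

/-! ## 3. Injective type, verticial slimness -/

/-- `𝓛′(p)` is of injective type: both geometric branch homomorphisms are injective.
[cite: MochizukiSemiAnbd2006, Def 2.1 p.22] -/
theorem quadLoopGraph_isOfInjectiveType : (quadLoopGraph p).IsOfInjectiveType :=
  fun b _ _ => geomBrHom_injective (brPoint p b)

/-- The geometric vertex group `πR ⋊ U_ℝ` is slim (abc-iut-w6-d099 gen 6, `centralizer_eq_bot_of_isOpen`, in
the tree's `IsSlimGroup` currency). [cite: MochizukiSemiAnbd2006, Def 2.4(ii) p.25] -/
theorem isSlimGroup_geomVertexGp : IsSlimGroup (geomVertexGp p) := ⟨centralizer_eq_bot_of_isOpen⟩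

/-- `𝓛′(p)` is verticially slim. [cite: MochizukiSemiAnbd2006, Def 2.4(ii) p.25] -/
theorem quadLoopGraph_isVerticiallySlim : (quadLoopGraph p).IsVerticiallySlim :=
  fun _ => isSlimGroup_geomVertexGp p

/-! ## 4. The loop is estranged (hence aloof) -/

variable {p}

/-- An element of the geometric vertex group lies in `piLevel` and in `ker aug`.
[cite: MochizukiSemiAnbd2006, Def 5.3 (iii), p. 65] -/
theorem coe_mem_piLevel_and_ker (g : geomVertexGp p) :
    (g : PadicQuadAffine p) ∈ piLevel p ∧ (g : PadicQuadAffine p) ∈ (aug (p := p)).ker := g.2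

/-- An element of `πR ⋊ U_ℝ` FIXING the branch point `y` lies in the branch group `B_y`: pushed into `G` it
lies in `Stab(y) ∩ ker aug`, the image of `geomBrHom y` (`map_range_geomBrHom`).
[cite: MochizukiSemiAnbd2006, Def 2.4(iv) p.26] -/
theorem mem_range_geomBrHom_of_act_eq {y : PadicQuad p} {g : geomVertexGp p}
    (h : act (g : PadicQuadAffine p) y = y) : g ∈ (geomBrHom (p := p) y).toMonoidHom.range := by
  have hmem : (g : PadicQuadAffine p) ∈ stab y ⊓ (aug (p := p)).ker :=
    Subgroup.mem_inf.mpr ⟨(mem_stab_iff y _).mpr h, (coe_mem_piLevel_and_ker g).2⟩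
  rw [← map_range_geomBrHom y] at hmem
  obtain ⟨g', hg', hgg'⟩ := Subgroup.mem_map.mp hmem
  rwa [← Subtype.ext hgg']

/-- **The branch point moves**: for branches `b, b′` and `g ∈ Π_v` with `b′ ≠ b` or `g ∉ B_b`, the point
`g · y_{b′}` differs from `y_b` (`g · 1 ≠ 0` and `g · 0 ≠ 1` on `piLevel`; `g · y = y` would put `g` in `B_y`).
[cite: MochizukiSemiAnbd2006, Def 2.4(iv) p.26] -/
theorem brPoint_ne_act_brPoint {b b' : (SemiGraph.bouquet.{0} 1).Branch} (g : geomVertexGp p)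
    (hg : b' ≠ b ∨ g ∉ (geomBrHom (p := p) (brPoint p b)).toMonoidHom.range) :
    brPoint p b ≠ act (g : PadicQuadAffine p) (brPoint p b') := by
  by_cases hbb : b' = b
  · subst hbb
    intro h
    exact (hg.resolve_left fun h' => h' rfl) (mem_range_geomBrHom_of_act_eq h.symm)
  · rcases brPoint_pair_of_ne p hbb with ⟨h0, h1⟩ | ⟨h1, h0⟩
    · rw [h0, h1]
      exact fun h => act_one_ne_zero (coe_mem_piLevel_and_ker g).1 h.symm
    · rw [h0, h1]
      exact fun h => act_zero_ne_one (coe_mem_piLevel_and_ker g).1 h.symm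

/-- A conjugate `g B_y g⁻¹` inside `πR ⋊ U_ℝ`, pushed into `G`, lies in `Stab(g · y) ∩ ker aug`.
[cite: MochizukiSemiAnbd2006, Def 2.4(iv) p.26] -/
theorem coe_mem_stab_act_of_mem_map_conj (y : PadicQuad p) (g : geomVertexGp p) {z : geomVertexGp p}
    (hz : z ∈ ((geomBrHom (p := p) y).toMonoidHom.range).map (MulAut.conj g).toMonoidHom) :
    (z : PadicQuadAffine p) ∈ stab (act (g : PadicQuadAffine p) y) ⊓ (aug (p := p)).ker := by
  obtain ⟨x, ⟨w, rfl⟩, rfl⟩ := Subgroup.mem_map.mp hz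
  refine Subgroup.mem_inf.mpr ⟨?_, ?_⟩
  · rw [← stab_map_conj]
    refine Subgroup.mem_map.mpr ⟨brElt y w, (Subgroup.mem_inf.mp (brElt_mem_stab_inf_ker y w)).1, ?_⟩
    rfl
  · have hg1 : aug (p := p) (g : PadicQuadAffine p) = 1 := (coe_mem_piLevel_and_ker g).2
    have hw1 : aug (p := p) (brElt y w) = 1 := (Subgroup.mem_inf.mp (brElt_mem_stab_inf_ker y w)).2
    rw [MonoidHom.mem_ker]
    change aug (p := p) ((g : PadicQuadAffine p) * brElt y w * (g : PadicQuadAffine p)⁻¹) = 1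
    rw [map_mul, map_mul, map_inv, hg1, hw1, mul_one, one_mul, inv_one]

/-- **The core intersection computation**: for branches `b, b′` of the loop and `g ∈ Π_v = πR ⋊ U_ℝ` with
`b′ ≠ b` or `g ∉ B_b`, `B_b ∩ g B_{b′} g⁻¹ = 1` — in `G` an element of `Stab(y) ∩ Stab(g·y′) ∩ ker aug` with
`y ≠ g·y′` has trivial linear part and translation (`QuadAffineWitness.stab_inf_ker_inf_eq_bot`: two fixed
points in the DOMAIN `ℤ_p[√p]`). [cite: MochizukiSemiAnbd2006, Def 2.4(iv) p.26] -/
theorem range_geomBrHom_inf_conj_eq_bot (b b' : (SemiGraph.bouquet.{0} 1).Branch) (g : geomVertexGp p)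
    (hg : b' ≠ b ∨ g ∉ (geomBrHom (p := p) (brPoint p b)).toMonoidHom.range) :
    (geomBrHom (p := p) (brPoint p b)).toMonoidHom.range ⊓
        ((geomBrHom (p := p) (brPoint p b')).toMonoidHom.range.map (MulAut.conj g).toMonoidHom) = ⊥ := by
  rw [eq_bot_iff]
  rintro z ⟨⟨w, rfl⟩, hz⟩
  rw [Subgroup.mem_bot]
  have hne := brPoint_ne_act_brPoint g hg
  have h1 : ((geomBrHom (p := p) (brPoint p b) w : geomVertexGp p) : PadicQuadAffine p) ∈
      stab (brPoint p b) ⊓ (aug (p := p)).ker := brElt_mem_stab_inf_ker _ w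
  have h2 := coe_mem_stab_act_of_mem_map_conj (brPoint p b') g hz
  have h12 : ((geomBrHom (p := p) (brPoint p b) w : geomVertexGp p) : PadicQuadAffine p) ∈
      (stab (brPoint p b) ⊓ (aug (p := p)).ker) ⊓ (stab (act (g : PadicQuadAffine p) (brPoint p b')) ⊓
        (aug (p := p)).ker) := Subgroup.mem_inf.mpr ⟨h1, h2⟩
  rw [stab_inf_ker_inf_eq_bot hne, Subgroup.mem_bot] at h12
  exact Subtype.ext h12

/-- The branch groups `B_y ≅ U_ℝ` are infinite. [cite: MochizukiSemiAnbd2006, Def 2.4(iv) p.26] -/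
theorem range_geomBrHom_infinite (y : PadicQuad p) :
    ((geomBrHom (p := p) y).toMonoidHom.range : Set (geomVertexGp p)).Infinite := by
  haveI : Infinite (real p) := Set.infinite_coe_iff.mpr real_infinite
  rw [MonoidHom.coe_range]
  exact Set.infinite_range_of_injective (geomBrHom_injective y)

/-- A subgroup meeting the infinite `B_y` trivially has relative index `0` (= infinite index) in it.
[cite: MochizukiSemiAnbd2006, Def 2.4(iv) p.26] -/
theorem relIndex_range_geomBrHom_eq_zero (y : PadicQuad p) {H : Subgroup (geomVertexGp p)}
    (h : (geomBrHom (p := p) y).toMonoidHom.range ⊓ H = ⊥) :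
    H.relIndex (geomBrHom (p := p) y).toMonoidHom.range = 0 := by
  haveI : Infinite ((geomBrHom (p := p) y).toMonoidHom.range) := Set.infinite_coe_iff.mpr (range_geomBrHom_infinite y)
  rw [Subgroup.relIndex, (Subgroup.subgroupOf_eq_bot).mpr (disjoint_iff.mpr (by rwa [inf_comm])),
    Subgroup.index_bot]
  exact Nat.card_eq_zero_of_infinite

variable (p)

/-- Every edge of `𝓛′(p)` is aloof: the intersections `B_b ∩ g B_{b′} g⁻¹` have infinite index in
`B_b ≅ U_ℝ`. [cite: MochizukiSemiAnbd2006, Def 2.4(iv) p.26] -/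
theorem quadLoopGraph_isTotallyAloof : (quadLoopGraph p).IsTotallyAloof := by
  intro e b _ v h b' h' g hg
  rw [quadLoopGraph_branchSubgroup] at hg ⊢
  rw [quadLoopGraph_branchSubgroup]
  exact relIndex_range_geomBrHom_eq_zero _ (range_geomBrHom_inf_conj_eq_bot b b' g hg)

/-- **Every edge of `𝓛′(p)` is estranged** (Def. 2.4 (iv)): aloof, and the intersections are trivial.
[cite: MochizukiSemiAnbd2006, Def 2.4(iv) p.26] -/
theorem quadLoopGraph_isTotallyEstranged : (quadLoopGraph p).IsTotallyEstranged := by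
  intro e
  refine ⟨quadLoopGraph_isTotallyAloof p e, ?_⟩
  intro b _ v h b' h' g hg
  rw [quadLoopGraph_branchSubgroup] at hg ⊢
  rw [quadLoopGraph_branchSubgroup]
  exact range_geomBrHom_inf_conj_eq_bot b b' g hg

/-! ## 5. Summary of part 1 -/

/-- **Part 1 of the stage-2a certificate**: the quadratic loop graph of anabelioids `𝓛′(p)` — an object WITH AN
EDGE whose vertex group is the geometric vertex group `πR ⋊ U_ℝ` of the quadratic affine carrier — is a
connected countable graph with a vertex, of injective type, verticially slim, totally aloof and totally
estranged (the non-approximator clauses of `Thm37Hypotheses` / `Cor39Hypotheses`), for every prime `p`.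
[cite: MochizukiSemiAnbd2006, Thm 3.7 p.40] -/
theorem exists_estranged_slim_quadLoop (p : ℕ) [Fact p.Prime] :
    ∃ 𝒢 : ProfiniteSemiGraph.{0}, Nonempty 𝒢.graph.Edge ∧ 𝒢.IsGraph ∧ 𝒢.HasVertex ∧ 𝒢.IsConnected ∧
      𝒢.IsCountable ∧ 𝒢.IsOfInjectiveType ∧ 𝒢.IsVerticiallySlim ∧ 𝒢.IsTotallyAloof ∧ 𝒢.IsTotallyEstranged ∧
      (∀ v, Nonempty (𝒢.Gv v ≃ₜ* geomVertexGp p)) ∧ ∀ e, Nonempty (𝒢.Ge e ≃ₜ* real p) :=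
  ⟨quadLoopGraph p, ⟨⟨0⟩⟩, quadLoopGraph_isGraph p, quadLoopGraph_hasVertex p, quadLoopGraph_isConnected p,
    quadLoopGraph_isCountable p, quadLoopGraph_isOfInjectiveType p, quadLoopGraph_isVerticiallySlim p,
    quadLoopGraph_isTotallyAloof p, quadLoopGraph_isTotallyEstranged p,
    fun _ => ⟨ContinuousMulEquiv.refl _⟩, fun _ => ⟨ContinuousMulEquiv.refl _⟩⟩

end QuadAffineWitness

end Literature.AnabelianGeometry.SemiGraphs

end
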